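import Summits.QuantumFields.BalabanUV.T4Continuum.Support.B13TermOpSecant
import Summits.QuantumFields.BalabanUV.T4Continuum.Support.OutputRateOpHolomorphic

/-!
# OutputRateActOpFibre — the ACTIVITY-LEVEL operator modulus of the NE5 swarm (`B13TermOpSecant.ActOpBound ∧ ActOpLip`, route P2's
# currency and the `hopL` producer of the secant END faces) PRODUCED by route P1's technique: one unit-disc Cauchy estimate per (2.14)
# FACTOR along complex operator lines — and, one level down, from the structural class of `OutputRateOpHolomorphic` (factors that are
# dominated holomorphic parametric integrals of the operator datum) (cell `pub-balaban`, T⁴ fan-out, `HOME/BINDER-OWNERS.md` row NE5,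
# owner lineage t4-ne5-p1, gen 28; LEAN PLACEMENT RULE 2026-08-19: our work under `Summits/`)

HONEST FRAMING (T4-DAG PAGE 1).  Rung (B)+1 on ONE finite four-torus of fixed physical size — NOT infinite volume, NOT a mass gap, NOT the
Clay problem; `FlowStep.BetaPertH`, (B), (B^μ) do not occur here.  NE5 (`T4OutputRate.NE5`) is NOT PRINTED and NOT PROVED (spine 0/9,
unchanged).  Nothing of Bałaban's series is asserted; 0 cite tags; every shape below is a parametrised `def … : Prop` asserted nowhere (cell
rule c3) or a theorem between such shapes.  HONEST DEPENDENCY (cell, verbatim): continuum YM on T⁴ ⇐ BetaPertH ∧ nine spine estimates (0/9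
proved); BetaPertH ⇐ (D1) ∧ (D4) ∧ CAP+tail; G-an2-4 gates asym, D1 and NE2/3/4.

WHAT THIS MODULE IS.  Route P2's `B13TermOpSecant` (p212487) relocated the operator half of W2 to the ACTIVITY level: `OpLipschitz M W κ G₁
ρ₀` ⟸ `ActOpBound 𝒯 act M W ρ₀ A` ∧ `ActOpLip 𝒯 act M W ρ₀ N A` ∧ d3's convergence binder ∧ a per-domain secant budget — the termwise
RELATIVE operator modulus `N` being «displayed, NOT PRINTED as a class statement».  Route P1's reading of the same factor: along every
complex operator line `p.1 + ζu`, `|ζ| ≤ 1`, `‖u‖ ≤ rOp k`, the factor `act Z j (p.1 + ζu) p.2` is complex differentiable on the closed unit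
disc and bounded by `A` (the FIBRE shape `ActOpFibre 𝒯 act M W A`, §1 — the activity-level twin of the leaf's `StepModel.OpFibreEnvelope`).
Then (§2) `ActOpBound … ρ₀ A` for every `0 ≤ ρ₀ ≤ 1` (`actOpBound_of_fibre`) and `ActOpLip … ρ₀ (1/(1 − ρ₀)) A` for every `ρ₀ < 1`
(`actOpLip_of_fibre`: ONE unit-disc Cauchy estimate per factor, the leaf's `T4InputCauchyRateData.norm_sub_le_of_unitDisc_near` BY
NAME) — the relative modulus is the UNIVERSAL constant `1/(1 − ρ₀)`; hence (§3) `opLipschitz_b13_of_actOpFibre` = P2's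
`opLipschitz_b13_of_actOpLip` with `hlip`/`habs` PRODUCED.  One level down (§4), the fibre shape itself follows from the structural class
of `OutputRateOpHolomorphic`: `ActOpIntegral 𝒯 act M W A μ f 𝒪` (each factor, at each base point, a dominated holomorphic parametric
integral of the operator datum on a domain containing the closed operator ball, with ONE majorant of mass `≤ A` on that ball) ⟹
`ActOpFibre` (`actOpFibre_of_integral`).
STATUS (census).  As for the termwise layer (walls sheet row W2-op∕STRUCTURAL): for Bałaban's (2.14) FACTORS what remains is (H-rep) the
dictionary and the MARGIN (locally uniform Gaussian domination on the complex operator ball of radius `rOp` — [II] (2.16) re-read with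
`R₁ ↦ R₁ + ζ·displacement`, NOT PRINTED, not citable); W2-op CONSTANT-only; no wall discharged from print; NE5 NOT PROVED; spine 0/9;
rung (B)+1 finite T⁴; NOT infinite volume / mass gap / Clay.  0 sorry; axioms ⊆ {propext, Classical.choice, Quot.sound}.
-/

noncomputable section

open Set Metric MeasureTheory Filter

namespace Summit.QuantumFields.BalabanUV.T4Continuum.OutputRateActOpFibre

open Literature.MathematicalPhysics.QuantumFieldTheory.Balaban1983to89
open Literature.MathematicalPhysics.QuantumFieldTheory.Balaban1983to89.T4OutputRate (Carriers)
open Literature.MathematicalPhysics.QuantumFieldTheory.Balaban1983to89.T4InputCauchyRateData (StepModel norm_sub_le_of_unitDisc_near)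
open Literature.MathematicalPhysics.QuantumFieldTheory.Balaban1983to89.T4InputCauchyRateSpecies (OpLipschitz)
open Summit.QuantumFields.BalabanUV.T4Continuum.B13StepTermFamily (TermIndexing out)
open Summit.QuantumFields.BalabanUV.T4Continuum.B13TermRep (actMajorant)
open Summit.QuantumFields.BalabanUV.T4Continuum.B13TermHistSecant (secMajorant)
open Summit.QuantumFields.BalabanUV.T4Continuum.B13TermOpSecant (ActOpBound ActOpLip opLipschitz_b13_of_actOpLip)
open Summit.QuantumFields.BalabanUV.T4Continuum.OutputRateOpHolomorphic (differentiableOn_integral_lineMap_of_dominated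
  norm_integral_le_of_majorant)

variable {C : Carriers} {ι P J Op Hist : Type*} [NormedAddCommGroup Op] [NormedSpace ℂ Op] [NormedAddCommGroup Hist]
  [NormedSpace ℂ Hist] (𝒯 : TermIndexing C ι P J) (inc : P → P → Prop) [DecidableRel inc] (act : P → J → Op → Hist → ℂ)
  (M : StepModel C Op Hist)

/-! ## §1 The fibre shape at activity level -/

/-- HYPOTHESIS SHAPE `ActOpFibre 𝒯 act M W A` ([analysis]; the activity-level twin of the leaf's `StepModel.OpFibreEnvelope`, asserted
nowhere): at every base point `p`, for every factor `(Z, j) = (𝒯.poly i m, 𝒯.lab i m)` of every term localizing at a step-`k` domain and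
every operator direction `u` within the operator margin, `ζ ↦ act Z j (p.1 + ζ•u) p.2` is complex differentiable on the closed unit disc and
bounded there by `A k g U Z j`. [folklore] -/
def ActOpFibre (W : Set (ℕ → ℝ)) (A : ℕ → (ℕ → ℝ) → C.BgB → P → J → ℝ) : Prop :=
  ∀ k, ∀ g ∈ W, ∀ (U : C.BgB) (p : Op × Hist), p ∈ M.Base k g U → ∀ X : C.Dom, C.scale X = k → ∀ i, 𝒯.Rel k i X → ∀ m,
    ∀ u : Op, ‖u‖ ≤ M.rOp k →
      DifferentiableOn ℂ (fun ζ : ℂ => act (𝒯.poly i m) (𝒯.lab i m) (p.1 + ζ • u) p.2) (closedBall 0 1) ∧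
        ∀ ζ ∈ closedBall (0 : ℂ) 1, ‖act (𝒯.poly i m) (𝒯.lab i m) (p.1 + ζ • u) p.2‖ ≤ A k g U (𝒯.poly i m) (𝒯.lab i m)

variable {𝒯 act M}

/-! ## §2 Fibre ⟹ bound and relative modulus (one unit-disc Cauchy estimate per factor) -/

/-- **FIBRE ⟹ `ActOpBound`**: for `0 ≤ ρ₀ ≤ 1`, an operator datum within reach `ρ₀·rOp k` of `p.1` is the end point `ζ = 1` of the line in
direction `u = o − p.1`, `‖u‖ ≤ rOp k`. [folklore] -/
theorem actOpBound_of_fibre {W : Set (ℕ → ℝ)} {A : ℕ → (ℕ → ℝ) → C.BgB → P → J → ℝ} {ρ₀ : ℝ} (hfib : ActOpFibre 𝒯 act M W A)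
    (hρ₀1 : ρ₀ ≤ 1) : ActOpBound 𝒯 act M W ρ₀ A := by
  intro k g hg U p hp o ho X hX i hi m
  have hu : ‖o - p.1‖ ≤ M.rOp k :=
    ho.trans ((mul_le_mul_of_nonneg_right hρ₀1 (M.rOp_pos k).le).trans_eq (one_mul _))
  have h1 : (1 : ℂ) ∈ closedBall (0 : ℂ) 1 := by rw [mem_closedBall, dist_zero_right, norm_one]
  have h := (hfib k g hg U p hp X hX i hi m (o - p.1) hu).2 1 h1
  simpa only [one_smul, add_sub_cancel] using h

/-- **FIBRE ⟹ `ActOpLip` WITH THE UNIVERSAL MODULUS `1/(1 − ρ₀)`** (route P1's technique per factor): at reach `ρ₀ < 1` the factor moves by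
at most `(1/(1 − ρ₀))·(‖o − p.1‖/rOp k)·A` — one unit-disc Cauchy estimate (`norm_sub_le_of_unitDisc_near`) along the line through `p.1` and
`o` rescaled to the operator margin. [folklore] -/
theorem actOpLip_of_fibre {W : Set (ℕ → ℝ)} {A : ℕ → (ℕ → ℝ) → C.BgB → P → J → ℝ} {ρ₀ : ℝ} (hfib : ActOpFibre 𝒯 act M W A)
    (hρ₀ : ρ₀ < 1) : ActOpLip 𝒯 act M W ρ₀ (fun _ _ _ _ _ => 1 / (1 - ρ₀)) A := by
  intro k g hg U p hp o ho X hX i hi m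
  have hrOp := M.rOp_pos k
  set a := ‖o - p.1‖ / M.rOp k with ha_def
  have ha0 : 0 ≤ a := by positivity
  have hqa : ‖o - p.1‖ = a * M.rOp k := by rw [ha_def, div_mul_cancel₀ _ hrOp.ne']
  have haρ : a ≤ ρ₀ := le_of_mul_le_mul_right (by rw [← hqa]; exact ho) hrOp
  rcases ha0.eq_or_lt with hzero | hpos
  · have h0 : ‖o - p.1‖ = 0 := by rw [hqa, ← hzero, zero_mul]
    rw [norm_eq_zero, sub_eq_zero] at h0
    rw [h0, sub_self, norm_zero, ← hzero, mul_zero, zero_mul]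
  · have hne : (a : ℂ) ≠ 0 := Complex.ofReal_ne_zero.mpr hpos.ne'
    set u : Op := (a : ℂ)⁻¹ • (o - p.1) with hu_def
    have hu : ‖u‖ ≤ M.rOp k := by
      rw [hu_def, norm_smul, norm_inv, Complex.norm_real, Real.norm_eq_abs, abs_of_pos hpos, hqa, inv_mul_cancel_left₀ hpos.ne']
    obtain ⟨hdiff, hbd⟩ := hfib k g hg U p hp X hX i hi m u hu
    have hend : p.1 + (a : ℂ) • u = o := by rw [hu_def, smul_smul, mul_inv_cancel₀ hne, one_smul, add_sub_cancel]
    have key := norm_sub_le_of_unitDisc_near hdiff hbd ha0 hρ₀ haρ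
    beta_reduce at key
    rw [hend, zero_smul, add_zero] at key
    calc ‖act (𝒯.poly i m) (𝒯.lab i m) o p.2 - act (𝒯.poly i m) (𝒯.lab i m) p.1 p.2‖
        ≤ A k g U (𝒯.poly i m) (𝒯.lab i m) / (1 - ρ₀) * a := key
      _ = 1 / (1 - ρ₀) * a * A k g U (𝒯.poly i m) (𝒯.lab i m) := by ring

/-! ## §3 Hence route P2's `OpLipschitz` producer with `habs`, `hlip` PRODUCED from the fibre shape -/

/-- **W2-op AT ACTIVITY LEVEL FROM THE FIBRE SHAPE**: `ActOpFibre 𝒯 act M W A` (with `A ≥ 0`), d3's convergence binder and the per-domain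
secant budget with the universal modulus `1/(1 − ρ₀)` (`0 ≤ ρ₀ < 1`) ⟹ `OpLipschitz M W κ G₁ ρ₀` for any step model whose output is the B13
series — P2's `opLipschitz_b13_of_actOpLip` BY NAME with `habs := actOpBound_of_fibre`, `hlip := actOpLip_of_fibre`. [folklore] -/
theorem opLipschitz_b13_of_actOpFibre (hM : ∀ k o h X, M.Out k o h X = out 𝒯 inc act k o h X) {W : Set (ℕ → ℝ)} {ρ₀ κ G₁ : ℝ}
    {A : ℕ → (ℕ → ℝ) → C.BgB → P → J → ℝ} (hρ₀ : 0 ≤ ρ₀) (hρ₀1 : ρ₀ < 1) (hA0 : ∀ k g U Z j, 0 ≤ A k g U Z j)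
    (hfib : ActOpFibre 𝒯 act M W A)
    (hconv : ∀ k, ∀ g ∈ W, ∀ (U : C.BgB) (X : C.Dom), C.scale X = k → Summable (actMajorant 𝒯 inc (A k g U) k X))
    (hmom : ∀ k, ∀ g ∈ W, ∀ (U : C.BgB) (X : C.Dom), C.scale X = k →
      Summable (secMajorant 𝒯 inc (fun _ _ => 1 / (1 - ρ₀)) (A k g U) k X) ∧
        ∑' i, secMajorant 𝒯 inc (fun _ _ => 1 / (1 - ρ₀)) (A k g U) k X i ≤ G₁ * Real.exp (-(κ * C.d X))) :
    OpLipschitz M W κ G₁ ρ₀ :=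
  opLipschitz_b13_of_actOpLip (N := fun _ _ _ _ _ => 1 / (1 - ρ₀)) hM hρ₀ hA0
    (fun _ _ _ _ _ => div_nonneg zero_le_one (sub_nonneg.2 hρ₀1.le)) (actOpBound_of_fibre hfib hρ₀1.le) (actOpLip_of_fibre hfib hρ₀1)
    hconv hmom

/-! ## §4 One level down: factors that are dominated holomorphic integrals of the operator datum satisfy the fibre shape -/

variable (𝒯 act M) in
/-- STRUCTURAL SHAPE `ActOpIntegral 𝒯 act M W A μ f 𝒪` ([analysis]; the activity-level form of `OutputRateOpHolomorphic.OutOpHolomorphic`,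
asserted nowhere): at every base point `p` and for every factor `(Z, j)` of every term localizing at a step-`k` domain, on an operator domain
`𝒪 k g U p Z j ⊇ closedBall p.1 (rOp k)` the factor at history `p.2` IS `∫ f … o a dμ` with an integrand a.e.-strongly measurable in `a`,
holomorphic in `o` on `𝒪` for a.e. `a`, locally uniformly dominated on `𝒪`, and dominated on the closed operator ball by ONE majorant of
mass `≤ A k g U Z j`. [folklore] -/
def ActOpIntegral (W : Set (ℕ → ℝ)) (A : ℕ → (ℕ → ℝ) → C.BgB → P → J → ℝ) {α : P → J → Type*}
    [∀ Z j, MeasurableSpace (α Z j)] (μ : ∀ Z j, ℕ → Hist → Measure (α Z j)) (f : ∀ Z j, ℕ → Hist → Op → α Z j → ℂ)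
    (𝒪 : ℕ → (ℕ → ℝ) → C.BgB → Op × Hist → P → J → Set Op) : Prop :=
  ∀ k, ∀ g ∈ W, ∀ (U : C.BgB) (p : Op × Hist), p ∈ M.Base k g U → ∀ X : C.Dom, C.scale X = k → ∀ i, 𝒯.Rel k i X → ∀ m,
    closedBall p.1 (M.rOp k) ⊆ 𝒪 k g U p (𝒯.poly i m) (𝒯.lab i m) ∧
    (∀ o ∈ 𝒪 k g U p (𝒯.poly i m) (𝒯.lab i m),
        AEStronglyMeasurable (f (𝒯.poly i m) (𝒯.lab i m) k p.2 o) (μ (𝒯.poly i m) (𝒯.lab i m) k p.2)) ∧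
    (∀ᵐ a ∂(μ (𝒯.poly i m) (𝒯.lab i m) k p.2),
        DifferentiableOn ℂ (fun o => f (𝒯.poly i m) (𝒯.lab i m) k p.2 o a) (𝒪 k g U p (𝒯.poly i m) (𝒯.lab i m))) ∧
    (∀ o₀ ∈ 𝒪 k g U p (𝒯.poly i m) (𝒯.lab i m), ∃ R : ℝ, 0 < R ∧ ball o₀ R ⊆ 𝒪 k g U p (𝒯.poly i m) (𝒯.lab i m) ∧
        ∃ bound : α (𝒯.poly i m) (𝒯.lab i m) → ℝ, Integrable bound (μ (𝒯.poly i m) (𝒯.lab i m) k p.2) ∧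
          ∀ᵐ a ∂(μ (𝒯.poly i m) (𝒯.lab i m) k p.2), ∀ o ∈ ball o₀ R, ‖f (𝒯.poly i m) (𝒯.lab i m) k p.2 o a‖ ≤ bound a) ∧
    (∃ bd : α (𝒯.poly i m) (𝒯.lab i m) → ℝ, Integrable bd (μ (𝒯.poly i m) (𝒯.lab i m) k p.2) ∧
        (∀ᵐ a ∂(μ (𝒯.poly i m) (𝒯.lab i m) k p.2), ∀ o ∈ closedBall p.1 (M.rOp k),
          ‖f (𝒯.poly i m) (𝒯.lab i m) k p.2 o a‖ ≤ bd a) ∧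
        ∫ a, bd a ∂(μ (𝒯.poly i m) (𝒯.lab i m) k p.2) ≤ A k g U (𝒯.poly i m) (𝒯.lab i m)) ∧
    (∀ o ∈ 𝒪 k g U p (𝒯.poly i m) (𝒯.lab i m),
        act (𝒯.poly i m) (𝒯.lab i m) o p.2 = ∫ a, f (𝒯.poly i m) (𝒯.lab i m) k p.2 o a ∂(μ (𝒯.poly i m) (𝒯.lab i m) k p.2))

/-- **STRUCTURE ⟹ FIBRE AT ACTIVITY LEVEL**: factors that are dominated holomorphic parametric integrals of the operator datum on domains
containing the closed operator balls satisfy `ActOpFibre` with the majorants' masses (§1 of `OutputRateOpHolomorphic` along each operator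
line, which stays in the closed operator ball). [folklore] -/
theorem actOpFibre_of_integral {W : Set (ℕ → ℝ)} {A : ℕ → (ℕ → ℝ) → C.BgB → P → J → ℝ} {α : P → J → Type*}
    [∀ Z j, MeasurableSpace (α Z j)] {μ : ∀ Z j, ℕ → Hist → Measure (α Z j)} {f : ∀ Z j, ℕ → Hist → Op → α Z j → ℂ}
    {𝒪 : ℕ → (ℕ → ℝ) → C.BgB → Op × Hist → P → J → Set Op} (hint : ActOpIntegral 𝒯 act M W A μ f 𝒪) :
    ActOpFibre 𝒯 act M W A := by
  intro k g hg U p hp X hX i hi m u hu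
  obtain ⟨hsub, hmeas, hdiff, hdom, ⟨bd, hbdi, hble, hbud⟩, hrepr⟩ := hint k g hg U p hp X hX i hi m
  have hline : MapsTo (fun ζ : ℂ => p.1 + ζ • u) (closedBall (0 : ℂ) 1) (closedBall p.1 (M.rOp k)) := by
    intro ζ hζ
    rw [mem_closedBall, dist_zero_right] at hζ
    rw [mem_closedBall, dist_eq_norm, add_sub_cancel_left, norm_smul]
    calc ‖ζ‖ * ‖u‖ ≤ 1 * M.rOp k := mul_le_mul hζ hu (norm_nonneg _) zero_le_one
      _ = M.rOp k := one_mul _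
  have hS : MapsTo (fun ζ : ℂ => p.1 + ζ • u) (closedBall (0 : ℂ) 1) (𝒪 k g U p (𝒯.poly i m) (𝒯.lab i m)) :=
    fun ζ hζ => hsub (hline hζ)
  refine ⟨(differentiableOn_integral_lineMap_of_dominated hmeas hdiff hdom p.1 u hS).congr fun ζ hζ => hrepr _ (hS hζ),
    fun ζ hζ => ?_⟩
  rw [hrepr _ (hS hζ)]
  exact (norm_integral_le_of_majorant hbdi (by filter_upwards [hble] with a ha using ha _ (hline hζ))).trans hbud

end Summit.QuantumFields.BalabanUV.T4Continuum.OutputRateActOpFibre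

end
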